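import Summits.NavierStokesRegularity.NavierStokesRegularity.Theorems.FilamentSkeletonRssSkeletonJ1RSingularBranchTools
import Summits.NavierStokesRegularity.NavierStokesRegularity.Theorems.FilamentSkeletonRssSkeletonJ1RBranchNonlinearity

/-!
# Route `FilamentSkeletonRss` · crux `SkeletonJ1R` (stmt-NavierStokesRegularity-23610) · registered line `streamline_kantorovich_R`
# — brick K-§3c for stub K `KantorovichClosingL`: UNIQUENESS OF THE NONLINEAR REGULAR BRANCH (variation of constants from the singular
# end + Grönwall)

Hand `ns-filament-21221-p1` (g18), `--supports stmt-NavierStokesRegularity-23610 --as helper`; pure Mathlib, route-independent.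

WHY.  K-notes §3 of the lead closes the exact-tangency argument with «uniqueness of the unstable manifold among invariant curves through a
hyperbolic point tangent to the unstable eigendirection».  In the parameterization currency of `…SkeletonJ1RSingularBranch.lean` /
`…SkeletonJ1RUnstableCurve.lean` (`P(s) = p + s q(s)`, branch equation `s q′ = K₀ q + s H(s, q)`), this is UNIQUENESS OF THE REGULAR BRANCH:
`singularBranch_unique` — two solutions of the branch equation on `(0, δ)` with values in `B̄(ξ, R)` and the same limit `ξ` at `0⁺` coincide.
Hypotheses as in `exists_singularBranch` (`K₀ ∘ Π = K₀`, bounded forward semigroup `‖exp(tK₀) Π v‖ ≤ C‖Π v‖`, `H` continuous and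
`L`-Lipschitz in `q` on `(0, δ₀] × B̄(ξ, R)`); NO spectral gap is needed (the initial value `q(0⁺) = ξ` is prescribed).  PROOF: `K₀` kills the
range of `1 − Π`, so `exp(tK₀)` is the identity there (= tree lemma `Literature.RepresentationTheory.CompactGroups.
exp_smul_apply_eq_self_of_apply_eq_zero`, carried as a private copy while that module has no hub olean) and the forward semigroup is bounded
on the whole space (`norm_exp_smul_apply_le_of_range`); for the difference `d = q₁ − q₂`, `Δ = H(·,q₁) − H(·,q₂)`, the conjugated function
`ψ(s) = exp((log x₀ − log s)K₀) d(s)` has `ψ′ = exp((log x₀ − log s)K₀) Δ(s)` (the `K₀`-terms cancel), whence by the fundamental theorem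
of calculus on `[x, x₀]` and `x → 0⁺`: `‖d(x₀)‖ ≤ C₂ L ∫₀^{x₀} ‖d‖`; Grönwall (`e^{−C₂Lx} ∫₀ˣ ‖d‖` is non-increasing) gives `d ≡ 0`.
CURVE LEVEL (`unstableCurve_unique_right`): two `C¹` solutions of `λ s P′(s) = f(P(s))` on `(0, δ)` in the cone `‖P(s) − p − sξ‖ ≤ R s`
with `(P(s) − p)/s → ξ` coincide (apply the branch uniqueness to `q = s⁻¹(P − p)`); the left arm `s < 0` is the right arm of
`s ↦ P(−s)` with `ξ ↦ −ξ` (same equation), so no separate statement is needed.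

HONEST FRAMING.  A generic ODE lemma, sub-brick of the OPEN stub K; stub K, the crux 23610 and its heart stay OPEN; MODEL rung, ∃-side of a
HYPOTHETICAL filament-type rotating-self-similar blow-up skeleton; nothing here is a claim about Navier–Stokes regularity or blow-up.
References: Coddington–Levinson (1955) Ch. 3 §8 (Levinson), Ch. 13 §4 (uniqueness of the stable manifold); Cabré–Fontich–de la Llave (2003) Thm 1.1.
-/

set_option linter.dupNamespace false -- `NavierStokesRegularity.NavierStokesRegularity` path/namespace repetition is the tree convention

noncomputable section

namespace Summit.NavierStokesRegularity.NavierStokesRegularity.Theorems.SkeletonJ1RUnstableCurve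

open Set Function Filter MeasureTheory intervalIntegral Metric NormedSpace
open scoped Topology

variable {E : Type*} [NormedAddCommGroup E] [NormedSpace ℝ E] [CompleteSpace E]

/-! ## §1 The forward semigroup of `K₀` on the whole space -/

-- adapted from Literature/RepresentationTheory/CompactGroups/DerivationFlows.lean
-- (`Literature.RepresentationTheory.CompactGroups.exp_smul_apply_eq_self_of_apply_eq_zero`, identical statement): that module's
-- import chain (`…LeftInvariantDerivations`) has NO hub olean on 2026-08-29 (farm `remote:stale:unbuilt`), so it cannot be imported
-- today; PRIVATE copy, to be deduplicated by import once the olean exists (cosmetic, append-only-safe).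
/-- `exp(tK) u = u` when `K u = 0` (the derivative `exp(tK)(K u)` vanishes). [folklore] -/
private theorem exp_smul_apply_of_apply_eq_zero' (K : E →L[ℝ] E) {u : E} (hu : K u = 0) (t : ℝ) :
    exp (t • K) u = u := by
  have hd : ∀ τ : ℝ, HasDerivAt (fun τ : ℝ => exp (τ • K) u) 0 τ := by
    intro τ
    have h := (hasDerivAt_exp_smul_const (𝕂 := ℝ) K τ).clm_apply (hasDerivAt_const τ u)
    simpa [hu] using h
  have hc := is_const_of_deriv_eq_zero (f := fun τ : ℝ => exp (τ • K) u) (fun τ => (hd τ).differentiableAt)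
    (fun τ => (hd τ).deriv) t 0
  simpa using hc

/-- If `K₀ ∘ Π = K₀` and the forward semigroup of `K₀` is bounded by `C` on the range of `Π`, then it is bounded on the whole space:
`‖exp(tK₀) w‖ ≤ (max C 0 · ‖Π‖ + 1 + ‖Π‖) ‖w‖` for `t ≥ 0` (`exp(tK₀)` is the identity on the range of `1 − Π`). [folklore] -/
theorem norm_exp_smul_apply_le_of_range {K₀ Pr : E →L[ℝ] E} {C : ℝ} (hK₀Pr : ∀ v, K₀ (Pr v) = K₀ v)
    (hbound : ∀ t : ℝ, 0 ≤ t → ∀ v : E, ‖exp (t • K₀) (Pr v)‖ ≤ C * ‖Pr v‖) {t : ℝ} (ht : 0 ≤ t) (w : E) :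
    ‖exp (t • K₀) w‖ ≤ (max C 0 * ‖Pr‖ + 1 + ‖Pr‖) * ‖w‖ := by
  have hker : K₀ (w - Pr w) = 0 := by rw [map_sub, hK₀Pr, sub_self]
  have hid : exp (t • K₀) (w - Pr w) = w - Pr w := exp_smul_apply_of_apply_eq_zero' K₀ hker t
  have hsplit : exp (t • K₀) w = exp (t • K₀) (Pr w) + (w - Pr w) := by
    rw [← hid, ← map_add, add_sub_cancel]
  rw [hsplit]
  have h1 : ‖exp (t • K₀) (Pr w)‖ ≤ max C 0 * ‖Pr‖ * ‖w‖ :=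
    calc ‖exp (t • K₀) (Pr w)‖ ≤ C * ‖Pr w‖ := hbound t ht w
      _ ≤ max C 0 * ‖Pr w‖ := mul_le_mul_of_nonneg_right (le_max_left _ _) (norm_nonneg _)
      _ ≤ max C 0 * (‖Pr‖ * ‖w‖) := mul_le_mul_of_nonneg_left (Pr.le_opNorm w) (le_max_right _ _)
      _ = max C 0 * ‖Pr‖ * ‖w‖ := by ring
  have h2 : ‖w - Pr w‖ ≤ (1 + ‖Pr‖) * ‖w‖ :=
    calc ‖w - Pr w‖ ≤ ‖w‖ + ‖Pr w‖ := norm_sub_le _ _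
      _ ≤ ‖w‖ + ‖Pr‖ * ‖w‖ := by gcongr; exact Pr.le_opNorm w
      _ = (1 + ‖Pr‖) * ‖w‖ := by ring
  calc ‖exp (t • K₀) (Pr w) + (w - Pr w)‖ ≤ ‖exp (t • K₀) (Pr w)‖ + ‖w - Pr w‖ := norm_add_le _ _
    _ ≤ max C 0 * ‖Pr‖ * ‖w‖ + (1 + ‖Pr‖) * ‖w‖ := add_le_add h1 h2
    _ = (max C 0 * ‖Pr‖ + 1 + ‖Pr‖) * ‖w‖ := by ring

/-- Derivative in `s` of the conjugating kernel `s ↦ exp((a − log s) K)` on `s > 0`: `−s⁻¹ K exp((a − log s) K)`. [folklore] -/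
theorem hasDerivAt_exp_sub_log_smul (K : E →L[ℝ] E) (a : ℝ) {s : ℝ} (hs : 0 < s) :
    HasDerivAt (fun σ : ℝ => exp ((a - Real.log σ) • K)) ((-s⁻¹) • (K * exp ((a - Real.log s) • K))) s := by
  have h1 : HasDerivAt (fun τ : ℝ => exp (τ • K)) (K * exp ((a - Real.log s) • K)) (a - Real.log s) :=
    hasDerivAt_exp_smul_const' (𝕂 := ℝ) K (a - Real.log s)
  have h2 : HasDerivAt (fun σ : ℝ => a - Real.log σ) (-s⁻¹) s := by
    simpa using (Real.hasDerivAt_log hs.ne').const_sub a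
  exact h1.scomp s h2

/-! ## §2 Grönwall from the singular end -/

omit [NormedSpace ℝ E] [CompleteSpace E] in
/-- **Grönwall from the singular end.** If `n : ℝ → ℝ` is nonnegative, continuous and bounded on `(0, δ)`, and
`n(x) ≤ K ∫₀ˣ n` for all `x ∈ (0, δ)`, then `n = 0` on `(0, δ)` (`x ↦ e^{−Kx} ∫₀ˣ n` is non-increasing and vanishes at `0`).
[folklore] -/
theorem eq_zero_of_le_integral {n : ℝ → ℝ} {δ K B : ℝ} (hn : ContinuousOn n (Ioo 0 δ))
    (hn0 : ∀ x, 0 ≤ n x) (hnB : ∀ x ∈ Ioo 0 δ, n x ≤ B)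
    (hle : ∀ x ∈ Ioo 0 δ, n x ≤ K * ∫ s in (0 : ℝ)..x, n s) : ∀ x ∈ Ioo 0 δ, n x = 0 := by
  have hB : ∀ x ∈ Ioo 0 δ, ‖n x‖ ≤ |B| := fun x hx => by
    rw [Real.norm_eq_abs, abs_of_nonneg (hn0 x)]; exact (hnB x hx).trans (le_abs_self B)
  -- integrability on `[0, y]`, `y < δ`
  have hint : ∀ y ∈ Ico 0 δ, IntervalIntegrable n volume 0 y := fun y hy =>
    intervalIntegrable_of_continuousOn_Ioc (E := ℝ) hy.1 (hn.mono fun s hs => ⟨hs.1, lt_of_le_of_lt hs.2 hy.2⟩)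
      fun s hs => hB s ⟨hs.1, lt_of_le_of_lt hs.2 hy.2⟩
  set N : ℝ → ℝ := fun x => ∫ s in (0 : ℝ)..x, n s with hN
  have hN0 : N 0 = 0 := by simp [hN]
  have hNnn : ∀ x, 0 ≤ x → 0 ≤ N x := fun x hx => intervalIntegral.integral_nonneg_of_forall hx hn0
  have hNb : ∀ x ∈ Ico 0 δ, ‖N x‖ ≤ |B| * x := fun x hx =>
    norm_integral_le_of_le_on_Ioc (E := ℝ) hx.1 fun s hs => hB s ⟨hs.1, lt_of_le_of_lt hs.2 hx.2⟩
  have hNd : ∀ x ∈ Ioo 0 δ, HasDerivAt N (n x) x := fun x hx =>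
    intervalIntegral.integral_hasDerivAt_right (hint x ⟨hx.1.le, hx.2⟩)
      (hn.stronglyMeasurableAtFilter isOpen_Ioo x hx) (hn.continuousAt (Ioo_mem_nhds hx.1 hx.2))
  -- `h(x) = e^{−Kx} N(x)` is non-increasing on `[0, δ)`
  set h : ℝ → ℝ := fun x => Real.exp (-(K * x)) * N x with hh
  have hhd : ∀ x ∈ Ioo 0 δ, HasDerivAt h (Real.exp (-(K * x)) * (n x - K * N x)) x := by
    intro x hx
    have he : HasDerivAt (fun y => Real.exp (-(K * y))) (Real.exp (-(K * x)) * (-K)) x := by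
      simpa using (((hasDerivAt_id x).const_mul K).neg).exp
    have h := he.mul (hNd x hx)
    refine h.congr_deriv ?_
    ring
  have hhc : ContinuousOn h (Ico 0 δ) := by
    intro x hx
    rcases hx.1.eq_or_lt with rfl | hx0
    · have hNc : ContinuousWithinAt N (Ico 0 δ) 0 := by
        rw [Metric.continuousWithinAt_iff]
        intro ε hε
        refine ⟨ε / (|B| + 1), by positivity, fun y hy hyd => ?_⟩
        rw [dist_eq_norm, hN0, sub_zero]
        rw [dist_zero_right, Real.norm_eq_abs, abs_of_nonneg hy.1] at hyd
        calc ‖N y‖ ≤ |B| * y := hNb y hy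
          _ ≤ (|B| + 1) * y := by nlinarith [hy.1, abs_nonneg B]
          _ < (|B| + 1) * (ε / (|B| + 1)) := mul_lt_mul_of_pos_left hyd (by positivity)
          _ = ε := by field_simp
      exact ((Real.continuous_exp.comp (continuous_const.mul continuous_id).neg).continuousWithinAt).mul hNc
    · exact (hhd x ⟨hx0, hx.2⟩).continuousAt.continuousWithinAt
  have hanti : AntitoneOn h (Ico 0 δ) := by
    refine antitoneOn_of_deriv_nonpos (convex_Ico 0 δ) hhc ?_ ?_
    · rw [interior_Ico]
      exact fun x hx => (hhd x hx).differentiableAt.differentiableWithinAt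
    · rw [interior_Ico]
      intro x hx
      rw [(hhd x hx).deriv]
      have h1 : n x - K * N x ≤ 0 := by linarith [hle x hx]
      exact mul_nonpos_of_nonneg_of_nonpos (Real.exp_nonneg _) h1
  intro x hx
  have hhx : h x ≤ h 0 := hanti ⟨le_rfl, hx.1.trans hx.2⟩ ⟨hx.1.le, hx.2⟩ hx.1.le
  have hh0 : h 0 = 0 := by simp [hh, hN0]
  have hNx0 : N x ≤ 0 := by
    rw [hh0] at hhx
    have he : 0 < Real.exp (-(K * x)) := Real.exp_pos _
    rcases lt_or_ge 0 (N x) with hpos | hnp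
    · have : 0 < Real.exp (-(K * x)) * N x := mul_pos he hpos
      simp only [hh] at hhx
      linarith
    · exact hnp
  have hNx : N x = 0 := le_antisymm hNx0 (hNnn x hx.1.le)
  have h1 := hle x hx
  simp only [hN] at hNx
  rw [hNx, mul_zero] at h1
  exact le_antisymm h1 (hn0 x)

/-! ## §3 Uniqueness of the regular branch -/

/-- **UNIQUENESS OF THE NONLINEAR REGULAR BRANCH.**  In the setting of `exists_singularBranch` (`K₀ ∘ Π = K₀`, bounded forward semigroup of
`K₀` on the range of `Π`, `H` continuous on `(0, δ₀] × B̄(ξ, R)` and `L`-Lipschitz in `q` there), two solutions `q₁, q₂` of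
`x q′ = K₀ q + x H(x, q)` on `(0, δ)` (`δ ≤ δ₀`) with values in `B̄(ξ, R)` and `qᵢ(x) → ξ` as `x → 0⁺` coincide on `(0, δ)`.  No spectral gap is
needed.  (Variation of constants from the singular end: `‖(q₁ − q₂)(x₀)‖ ≤ C₂ L ∫₀^{x₀} ‖q₁ − q₂‖`, then Grönwall.)
[cite: CoddingtonLevinson1955, Ch. 3 §8 and Ch. 13 §4] -/
theorem singularBranch_unique {K₀ Pr : E →L[ℝ] E} {H : ℝ → E → E} {ξ : E} {δ₀ δ C L R : ℝ} {q₁ q₂ q₁' q₂' : ℝ → E}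
    (hδle : δ ≤ δ₀) (hL : 0 ≤ L)
    (hK₀Pr : ∀ v, K₀ (Pr v) = K₀ v)
    (hbound : ∀ t : ℝ, 0 ≤ t → ∀ v : E, ‖exp (t • K₀) (Pr v)‖ ≤ C * ‖Pr v‖)
    (hHc : ContinuousOn (uncurry H) (Ioc 0 δ₀ ×ˢ closedBall ξ R))
    (hHL : ∀ s ∈ Ioc 0 δ₀, ∀ q ∈ closedBall ξ R, ∀ q' ∈ closedBall ξ R, ‖H s q - H s q'‖ ≤ L * ‖q - q'‖)
    (h₁d : ∀ x ∈ Ioo 0 δ, HasDerivAt q₁ (q₁' x) x) (h₂d : ∀ x ∈ Ioo 0 δ, HasDerivAt q₂ (q₂' x) x)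
    (h₁e : ∀ x ∈ Ioo 0 δ, x • q₁' x = K₀ (q₁ x) + x • H x (q₁ x))
    (h₂e : ∀ x ∈ Ioo 0 δ, x • q₂' x = K₀ (q₂ x) + x • H x (q₂ x))
    (h₁R : ∀ x ∈ Ioo 0 δ, ‖q₁ x - ξ‖ ≤ R) (h₂R : ∀ x ∈ Ioo 0 δ, ‖q₂ x - ξ‖ ≤ R)
    (h₁0 : Tendsto q₁ (𝓝[>] 0) (𝓝 ξ)) (h₂0 : Tendsto q₂ (𝓝[>] 0) (𝓝 ξ)) :
    EqOn q₁ q₂ (Ioo 0 δ) := by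
  set C₂ : ℝ := max C 0 * ‖Pr‖ + 1 + ‖Pr‖ with hC₂
  have hC₂0 : 0 ≤ C₂ := by positivity
  have hsg : ∀ {t : ℝ}, 0 ≤ t → ∀ w : E, ‖exp (t • K₀) w‖ ≤ C₂ * ‖w‖ := fun ht w =>
    norm_exp_smul_apply_le_of_range hK₀Pr hbound ht w
  set d : ℝ → E := fun x => q₁ x - q₂ x with hd
  set Δ : ℝ → E := fun x => H x (q₁ x) - H x (q₂ x) with hΔ
  -- continuity on `(0, δ)`
  have hmem : ∀ {i : ℝ → E}, (∀ x ∈ Ioo 0 δ, ‖i x - ξ‖ ≤ R) → ∀ x ∈ Ioo 0 δ, i x ∈ closedBall ξ R :=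
    fun hi x hx => mem_closedBall.2 (by rw [dist_eq_norm]; exact hi x hx)
  have hq₁c : ContinuousOn q₁ (Ioo 0 δ) := fun x hx => (h₁d x hx).continuousAt.continuousWithinAt
  have hq₂c : ContinuousOn q₂ (Ioo 0 δ) := fun x hx => (h₂d x hx).continuousAt.continuousWithinAt
  have hHic : ∀ {i : ℝ → E}, ContinuousOn i (Ioo 0 δ) → (∀ x ∈ Ioo 0 δ, ‖i x - ξ‖ ≤ R) →
      ContinuousOn (fun x => H x (i x)) (Ioo 0 δ) := by
    intro i hic hiR
    have hmaps : MapsTo (fun x => (x, i x)) (Ioo 0 δ) (Ioc 0 δ₀ ×ˢ closedBall ξ R) := fun x hx =>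
      ⟨⟨hx.1, hx.2.le.trans hδle⟩, hmem hiR x hx⟩
    exact hHc.comp (continuousOn_id.prodMk hic) hmaps
  have hdc : ContinuousOn d (Ioo 0 δ) := hq₁c.sub hq₂c
  have hΔc : ContinuousOn Δ (Ioo 0 δ) := (hHic hq₁c h₁R).sub (hHic hq₂c h₂R)
  have hΔL : ∀ x ∈ Ioo 0 δ, ‖Δ x‖ ≤ L * ‖d x‖ := fun x hx =>
    hHL x ⟨hx.1, hx.2.le.trans hδle⟩ _ (hmem h₁R x hx) _ (hmem h₂R x hx)
  have hd0 : Tendsto (fun x => ‖d x‖) (𝓝[>] 0) (𝓝 0) := by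
    have h := (h₁0.sub h₂0).norm
    simpa [hd] using h
  -- the key estimate: variation of constants on `[x, x₀]`
  have hkey : ∀ x x₀ : ℝ, 0 < x → x ≤ x₀ → x₀ < δ →
      ‖d x₀‖ ≤ C₂ * ‖d x‖ + C₂ * L * ∫ s in x..x₀, ‖d s‖ := by
    intro x x₀ hx hxx₀ hx₀
    set a : ℝ := Real.log x₀ with ha
    set c : ℝ → E →L[ℝ] E := fun s => exp ((a - Real.log s) • K₀) with hc
    have hIoo : ∀ {s}, s ∈ Icc x x₀ → s ∈ Ioo 0 δ := fun hs => ⟨lt_of_lt_of_le hx hs.1, lt_of_le_of_lt hs.2 hx₀⟩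
    -- derivative of `ψ = c • d`
    have hψd : ∀ s ∈ Icc x x₀, HasDerivAt (fun σ => c σ (d σ)) (c s (Δ s)) s := by
      intro s hs
      have hs0 : 0 < s := lt_of_lt_of_le hx hs.1
      have hsI := hIoo hs
      have hcd : HasDerivAt c ((-s⁻¹) • (K₀ * c s)) s := hasDerivAt_exp_sub_log_smul K₀ a hs0
      have hdd : HasDerivAt d (q₁' s - q₂' s) s := (h₁d s hsI).sub (h₂d s hsI)
      have h := hcd.clm_apply hdd
      refine h.congr_deriv ?_
      -- `q₁' − q₂' = s⁻¹ K₀ d + Δ`, and `K₀` commutes with `c s`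
      have hq' : q₁' s - q₂' s = s⁻¹ • K₀ (d s) + Δ s := by
        have e1 : q₁' s = s⁻¹ • (K₀ (q₁ s) + s • H s (q₁ s)) := by
          rw [← h₁e s hsI, smul_smul, inv_mul_cancel₀ hs0.ne', one_smul]
        have e2 : q₂' s = s⁻¹ • (K₀ (q₂ s) + s • H s (q₂ s)) := by
          rw [← h₂e s hsI, smul_smul, inv_mul_cancel₀ hs0.ne', one_smul]
        rw [e1, e2]
        simp only [hd, hΔ, map_sub, smul_add, smul_sub, smul_smul, inv_mul_cancel₀ hs0.ne', one_smul]
        abel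
      have hcomm : K₀ * c s = c s * K₀ := by
        have h := ((Commute.refl K₀).smul_right (a - Real.log s)).exp_right
        exact h.eq
      have hcommv : ∀ v, K₀ (c s v) = c s (K₀ v) := fun v => by
        have h := congrArg (fun T : E →L[ℝ] E => T v) hcomm
        simpa using h
      have e' : ((-s⁻¹) • (K₀ * c s)) (d s) = (-s⁻¹) • K₀ (c s (d s)) := rfl
      rw [hq', map_add, map_smul, e', hcommv]
      simp only [neg_smul]
      abel
    -- fundamental theorem of calculus on `[x, x₀]`
    have hgc : ContinuousOn (fun s => c s (Δ s)) (Icc x x₀) := by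
      have hcc : ContinuousOn c (Icc x x₀) := by
        have h1 : ContinuousOn (fun s : ℝ => a - Real.log s) (Icc x x₀) :=
          continuousOn_const.sub (Real.continuousOn_log.mono fun s hs => (lt_of_lt_of_le hx hs.1).ne')
        exact (continuous_exp_smul K₀).comp_continuousOn h1
      exact hcc.clm_apply (hΔc.mono fun s hs => hIoo hs)
    have hFTC := intervalIntegral.integral_eq_sub_of_hasDerivAt
      (fun s hs => hψd s (by rwa [uIcc_of_le hxx₀] at hs)) (hgc.intervalIntegrable_of_Icc hxx₀)
    have hψ₀ : c x₀ (d x₀) = d x₀ := by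
      have h1 : c x₀ = 1 := by simp only [hc, ha, sub_self, zero_smul, exp_zero]
      rw [h1]; rfl
    rw [hψ₀] at hFTC
    -- `d x₀ = c x (d x) + ∫ c Δ`
    have hdx₀ : d x₀ = c x (d x) + ∫ s in x..x₀, c s (Δ s) := by rw [hFTC]; abel
    have hψx : ‖c x (d x)‖ ≤ C₂ * ‖d x‖ := by
      have ht : 0 ≤ a - Real.log x := by have := Real.log_le_log hx hxx₀; rw [ha]; linarith
      exact hsg ht (d x)
    have hI : ‖∫ s in x..x₀, c s (Δ s)‖ ≤ ∫ s in x..x₀, C₂ * L * ‖d s‖ := by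
      refine intervalIntegral.norm_integral_le_of_norm_le hxx₀ ?_ ?_
      · refine Filter.Eventually.of_forall fun s hs => ?_
        have hsI : s ∈ Icc x x₀ := ⟨hs.1.le, hs.2⟩
        have ht : 0 ≤ a - Real.log s := by
          have := Real.log_le_log (lt_of_lt_of_le hx hsI.1) hsI.2; rw [ha]; linarith
        calc ‖c s (Δ s)‖ ≤ C₂ * ‖Δ s‖ := hsg ht (Δ s)
          _ ≤ C₂ * (L * ‖d s‖) := mul_le_mul_of_nonneg_left (hΔL s (hIoo hsI)) hC₂0
          _ = C₂ * L * ‖d s‖ := by ring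
      · exact ((hdc.mono fun s hs => hIoo hs).norm.intervalIntegrable_of_Icc hxx₀).const_mul _
    rw [intervalIntegral.integral_const_mul] at hI
    calc ‖d x₀‖ = ‖c x (d x) + ∫ s in x..x₀, c s (Δ s)‖ := by rw [← hdx₀]
      _ ≤ ‖c x (d x)‖ + ‖∫ s in x..x₀, c s (Δ s)‖ := norm_add_le _ _
      _ ≤ C₂ * ‖d x‖ + C₂ * L * ∫ s in x..x₀, ‖d s‖ := add_le_add hψx hI
  -- pass to the limit `x → 0⁺`: `‖d x₀‖ ≤ C₂ L ∫₀^{x₀} ‖d‖`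
  set n : ℝ → ℝ := fun x => ‖d x‖ with hn
  have hnc : ContinuousOn n (Ioo 0 δ) := hdc.norm
  have hnB : ∀ x ∈ Ioo 0 δ, n x ≤ R + R := fun x hx => by
    calc ‖d x‖ = ‖(q₁ x - ξ) - (q₂ x - ξ)‖ := by simp only [hd]; abel_nf
      _ ≤ ‖q₁ x - ξ‖ + ‖q₂ x - ξ‖ := norm_sub_le _ _
      _ ≤ R + R := add_le_add (h₁R x hx) (h₂R x hx)
  have hnint : ∀ y ∈ Ico 0 δ, IntervalIntegrable n volume 0 y := fun y hy =>
    intervalIntegrable_of_continuousOn_Ioc (E := ℝ) hy.1 (hnc.mono fun s hs => ⟨hs.1, lt_of_le_of_lt hs.2 hy.2⟩)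
      fun s hs => by
        rw [Real.norm_eq_abs, abs_of_nonneg (norm_nonneg _)]
        exact hnB s ⟨hs.1, lt_of_le_of_lt hs.2 hy.2⟩
  have hle : ∀ x₀ ∈ Ioo 0 δ, n x₀ ≤ C₂ * L * ∫ s in (0 : ℝ)..x₀, n s := by
    intro x₀ hx₀
    have hev : ∀ᶠ x in 𝓝[>] (0 : ℝ), n x₀ ≤ C₂ * n x + C₂ * L * ∫ s in (0 : ℝ)..x₀, n s := by
      filter_upwards [Ioo_mem_nhdsGT hx₀.1] with x hx
      have h1 := hkey x x₀ hx.1 hx.2.le hx₀.2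
      have hsplit : (∫ s in (0 : ℝ)..x, n s) + ∫ s in x..x₀, n s = ∫ s in (0 : ℝ)..x₀, n s :=
        intervalIntegral.integral_add_adjacent_intervals (hnint x ⟨hx.1.le, hx.2.trans hx₀.2⟩)
          ((hnc.mono fun s hs => ⟨lt_of_lt_of_le hx.1 hs.1, lt_of_le_of_lt hs.2 hx₀.2⟩).intervalIntegrable_of_Icc
            hx.2.le)
      have hN0x : 0 ≤ ∫ s in (0 : ℝ)..x, n s := intervalIntegral.integral_nonneg_of_forall hx.1.le fun u => norm_nonneg _
      have h2 : ∫ s in x..x₀, n s ≤ ∫ s in (0 : ℝ)..x₀, n s := by linarith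
      have h3 : C₂ * L * ∫ s in x..x₀, n s ≤ C₂ * L * ∫ s in (0 : ℝ)..x₀, n s :=
        mul_le_mul_of_nonneg_left h2 (by positivity)
      simp only [hn] at h1 ⊢
      linarith
    have hlim : Tendsto (fun x => C₂ * n x + C₂ * L * ∫ s in (0 : ℝ)..x₀, n s) (𝓝[>] 0)
        (𝓝 (C₂ * 0 + C₂ * L * ∫ s in (0 : ℝ)..x₀, n s)) :=
      (hd0.const_mul C₂).add tendsto_const_nhds
    rw [mul_zero, zero_add] at hlim
    exact ge_of_tendsto hlim hev
  have hzero := eq_zero_of_le_integral (B := R + R) hnc (fun x => norm_nonneg _) hnB hle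
  intro x hx
  have h := hzero x hx
  simp only [hn, hd, norm_eq_zero, sub_eq_zero] at h
  exact h

/-! ## §4 Uniqueness of the unstable curve (right arm) -/

/-- **UNIQUENESS OF THE UNSTABLE CURVE (right arm).**  Under the hypotheses of `exists_unstableCurve` (`f p = 0`, `Df` Lipschitz at `p` on
`B(p, ρ₀)`, `(A − λ)(1 − Π) = 0`, `‖exp(tA) Π v‖ ≤ C e^{λt} ‖Π v‖`), two solutions `P₁, P₂` of `λ s P′(s) = f(P(s))` on `(0, δ)`
(`δ (‖ξ‖ + R) < ρ₀`) lying in the cone `‖Pᵢ(s) − p − s ξ‖ ≤ R s` and tangent to `ξ` (`s⁻¹(Pᵢ(s) − p) → ξ` as `s → 0⁺`) coincide on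
`(0, δ)`.  The left arm is the right arm of `s ↦ P(−s)` (same equation, `ξ ↦ −ξ`).  No spectral gap is used.
[cite: CoddingtonLevinson1955, Ch. 13 §4 (uniqueness of the (un)stable manifold)] -/
theorem unstableCurve_unique_right {f : E → E} {f' : E → E →L[ℝ] E} {Pr : E →L[ℝ] E} {p ξ : E} {lam C ω ρ₀ R δ : ℝ}
    {P₁ P₂ P₁' P₂' : ℝ → E}
    (hlam : 0 < lam) (hω : 0 ≤ ω) (hR : 0 ≤ R) (hδρ : δ * (‖ξ‖ + R) < ρ₀)
    (hf0 : f p = 0) (hfd : ∀ y ∈ ball p ρ₀, HasFDerivAt f (f' y) y)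
    (hlip : ∀ y ∈ ball p ρ₀, ‖f' y - f' p‖ ≤ ω * ‖y - p‖)
    (hAPr : ∀ v, f' p v - f' p (Pr v) = lam • (v - Pr v))
    (hexpA : ∀ t : ℝ, 0 ≤ t → ∀ v : E, ‖exp (t • f' p) (Pr v)‖ ≤ C * Real.exp (lam * t) * ‖Pr v‖)
    (h₁d : ∀ s ∈ Ioo 0 δ, HasDerivAt P₁ (P₁' s) s) (h₂d : ∀ s ∈ Ioo 0 δ, HasDerivAt P₂ (P₂' s) s)
    (h₁e : ∀ s ∈ Ioo 0 δ, (lam * s) • P₁' s = f (P₁ s)) (h₂e : ∀ s ∈ Ioo 0 δ, (lam * s) • P₂' s = f (P₂ s))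
    (h₁c : ∀ s ∈ Ioo 0 δ, ‖P₁ s - p - s • ξ‖ ≤ R * s) (h₂c : ∀ s ∈ Ioo 0 δ, ‖P₂ s - p - s • ξ‖ ≤ R * s)
    (h₁t : Tendsto (fun s => s⁻¹ • (P₁ s - p)) (𝓝[>] 0) (𝓝 ξ))
    (h₂t : Tendsto (fun s => s⁻¹ • (P₂ s - p)) (𝓝[>] 0) (𝓝 ξ)) :
    EqOn P₁ P₂ (Ioo 0 δ) := by
  set A : E →L[ℝ] E := f' p with hA
  set K₀ : E →L[ℝ] E := lam⁻¹ • A - 1 with hK₀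
  have hK₀w : ∀ w, K₀ w = lam⁻¹ • A w - w := fun w => rfl
  have hK₀Pr : ∀ v, K₀ (Pr v) = K₀ v := by
    intro v
    have h : lam⁻¹ • A v - lam⁻¹ • A (Pr v) = v - Pr v := by
      rw [← smul_sub, hAPr v, smul_smul, inv_mul_cancel₀ hlam.ne', one_smul]
    rw [hK₀w, hK₀w]
    exact (sub_eq_sub_iff_sub_eq_sub.1 h).symm
  have hbound : ∀ t : ℝ, 0 ≤ t → ∀ v : E, ‖exp (t • K₀) (Pr v)‖ ≤ C * ‖Pr v‖ :=
    norm_exp_smul_branchK_apply_le hlam hexpA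
  set H : ℝ → E → E := fun s q => (1 : ℝ) • ((lam * s ^ 2)⁻¹ • (f (p + ((1 : ℝ) * s) • q) - A (((1 : ℝ) * s) • q))) with hH
  obtain ⟨-, hL, hc⟩ := branchH_estimates (σ := 1) (δ₀ := δ) (H := H) hlam hω hR (Or.inl rfl) hδρ hf0 hfd hlip (fun _ _ => rfl)
  -- the branch functions `qᵢ = s⁻¹ (Pᵢ − p)`
  set q₁ : ℝ → E := fun s => s⁻¹ • (P₁ s - p) with hq₁
  set q₂ : ℝ → E := fun s => s⁻¹ • (P₂ s - p) with hq₂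
  set q₁' : ℝ → E := fun s => s⁻¹ • P₁' s + (-(s ^ 2)⁻¹) • (P₁ s - p) with hq₁'
  set q₂' : ℝ → E := fun s => s⁻¹ • P₂' s + (-(s ^ 2)⁻¹) • (P₂ s - p) with hq₂'
  have hqd : ∀ {P P' : ℝ → E}, (∀ s ∈ Ioo 0 δ, HasDerivAt P (P' s) s) → ∀ s ∈ Ioo 0 δ,
      HasDerivAt (fun s => s⁻¹ • (P s - p)) (s⁻¹ • P' s + (-(s ^ 2)⁻¹) • (P s - p)) s := by
    intro P P' hPd s hs
    exact ((hasDerivAt_inv hs.1.ne').smul ((hPd s hs).sub_const p))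
  have hqe : ∀ {P P' : ℝ → E}, (∀ s ∈ Ioo 0 δ, (lam * s) • P' s = f (P s)) → ∀ s ∈ Ioo 0 δ,
      s • (s⁻¹ • P' s + (-(s ^ 2)⁻¹) • (P s - p)) = K₀ (s⁻¹ • (P s - p)) + s • H s (s⁻¹ • (P s - p)) := by
    intro P P' hPe s hs
    have hs0 : s ≠ 0 := hs.1.ne'
    have hP' : P' s = (lam * s)⁻¹ • f (P s) := by
      rw [← hPe s hs, smul_smul, inv_mul_cancel₀ (mul_ne_zero hlam.ne' hs0), one_smul]
    have e1 : s • (s⁻¹ • P' s + (-(s ^ 2)⁻¹) • (P s - p)) = P' s - s⁻¹ • (P s - p) := by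
      rw [smul_add, smul_smul, mul_inv_cancel₀ hs0, one_smul, smul_smul,
        show s * -(s ^ 2)⁻¹ = -s⁻¹ by field_simp, neg_smul, ← sub_eq_add_neg]
    have e2 : ((1 : ℝ) * s) • (s⁻¹ • (P s - p)) = P s - p := by
      rw [one_mul, smul_smul, mul_inv_cancel₀ hs0, one_smul]
    have e3 : H s (s⁻¹ • (P s - p)) = (lam * s ^ 2)⁻¹ • (f (P s) - A (P s - p)) := by
      simp only [hH]
      rw [one_smul, e2, add_sub_cancel]
    have e4 : K₀ (s⁻¹ • (P s - p)) = (lam * s)⁻¹ • A (P s - p) - s⁻¹ • (P s - p) := by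
      rw [hK₀w, map_smul, smul_smul, ← mul_inv]
    rw [e1, e3, e4, hP', smul_smul, show s * (lam * s ^ 2)⁻¹ = (lam * s)⁻¹ by field_simp]
    simp only [smul_sub]
    abel
  have hqR : ∀ {P : ℝ → E}, (∀ s ∈ Ioo 0 δ, ‖P s - p - s • ξ‖ ≤ R * s) → ∀ s ∈ Ioo 0 δ, ‖s⁻¹ • (P s - p) - ξ‖ ≤ R := by
    intro P hPc s hs
    have hs0 : s ≠ 0 := hs.1.ne'
    have e : s⁻¹ • (P s - p) - ξ = s⁻¹ • (P s - p - s • ξ) := by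
      simp only [smul_sub, smul_smul, inv_mul_cancel₀ hs0, one_smul]
    rw [e, norm_smul, norm_inv, Real.norm_eq_abs, abs_of_pos hs.1]
    calc s⁻¹ * ‖P s - p - s • ξ‖ ≤ s⁻¹ * (R * s) := mul_le_mul_of_nonneg_left (hPc s hs) (inv_nonneg.2 hs.1.le)
      _ = R := by field_simp
  have hL0 : 0 ≤ ω * (‖ξ‖ + R) / lam := by positivity
  have hEq := singularBranch_unique (q₁ := q₁) (q₂ := q₂) (q₁' := q₁') (q₂' := q₂') le_rfl hL0 hK₀Pr hbound hc hL
    (hqd h₁d) (hqd h₂d) (hqe h₁e) (hqe h₂e) (hqR h₁c) (hqR h₂c) h₁t h₂t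
  intro s hs
  have h := hEq hs
  have hs0 : s ≠ 0 := hs.1.ne'
  simp only [hq₁, hq₂] at h
  have h2 := congrArg (fun v => p + s • v) h
  simpa [smul_smul, mul_inv_cancel₀ hs0] using h2

end Summit.NavierStokesRegularity.NavierStokesRegularity.Theorems.SkeletonJ1RUnstableCurve

end
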